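import Summits.ResolutionOfSingularities.ResolutionOfSingularities.Theorems.EquisingularLiftEquisingularLiftNatEquimultipleStrictTransform
import Summits.ResolutionOfSingularities.ResolutionOfSingularities.Theorems.EquisingularLiftEquisingularLiftNatTieCubicBlowup
import Summits.ResolutionOfSingularities.ResolutionOfSingularities.Theorems.EquisingularLiftEquisingularLiftNatCarrierDeltaStalks
import Literature.AlgebraicGeometry.Resolution.AdicCompletionRegular
import HarnessLib

/-!
# [OURS · L1 W4.5(b) · EL♮(3)] T-EBETA-PRIME, part 4 (scheme level): the STALKS of the strict transform of a
# hypersurface with given tangent cone at the points of a blow-up, and their REGULARITY where the cone is smooth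

Support file of the crux chain w45b (cell `res-hironaka`, LADDER-RESOLUTION rung L, slot W4.5(b)), working crux
**EL♮ = `Theses.EquisingularLift.EquisingularLiftNat`** (stmt-ResolutionOfSingularities-20038) and its `n = 3` child
`EquisingularLiftNatThree` (stmt-ResolutionOfSingularities-20148), registered stub `stub_elnat_three_isolated_nontc`
(K4.5e arm T, route T-B (E-β′)). OURS; NOT a statement of any manuscript; AI-written, weaker than expert review. Filed
`--supports stmt-ResolutionOfSingularities-20148 --as helper` by res-L1-w45b-stub-3 (object T-EBETA-PRIME, scheme packaging
of parts 1–3 = `…NatSmoothConeBlowupChart` p511641, `…NatSmoothConeBlowup` p512906, `…NatTieCubicBlowup` p514128).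

SETTING (res-type-100's stalk dictionary `…NatCarrierDeltaStalks`, p509910-class, generalised from the pure cone
`K = V(Φ(c))` to `K = V(Φ(c) + Ψ)`): `τ : X' → X` a blow-up along `J` (`IsBlowup`), `X'` locally Noetherian, `x' ∈ X'` with
`p = τ x' ∈ supp J`; at `R = 𝒪_{X,p}`: `J_p = (c₁, …, c_r)` with `c` quasi-regular and `R/(c)` a domain, and
`K_p = (Φ(c) + Ψ)` with `Φ` a FORM of degree `d` over `R`, `Φ̄ = Φ mod (c) ≠ 0`, `Ψ ∈ (c)^{d+1}` — i.e. `V(Φ̄)` is the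
tangent cone of the hypersurface `V(K)` along `V(J)` at `p`.

* `exists_stalk_strictTransformIdeal_of_tangentCone` — for some chart `j`, a prime `𝔔` of `B = R[I/c_j]` over `𝔪_R`, a ring
  map `χ : B → 𝒪_{X',x'}` over `τ^♯_{x'}` and `e : 𝒪_{X',x'} ≅ B_𝔔` with `e ∘ χ = (·/1)`, and some `ψ ∈ B` with
  `Φ(c) + Ψ = (c_j/1)ᵈ · g₁`, `g₁ = Φ(c/c_j) + (c_j/1)ψ` (part 1): `E_{x'} = (χ(c_j/1))`, **`St_τ(K)_{x'} = (χ g₁)`**,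
  `c_j/1 ∈ 𝔔`, and `x' ∈ supp St_τ(K) ↔ g₁ ∈ 𝔔`;
* **`isRegularLocalRing_stalk_quotient_strictTransform_of_mem_span`** — if moreover `R` and `R/(c)` are regular (`R` is
  the local ring of a regular scheme; `V(J)` regular at `p`) and the projectivised tangent cone is SMOOTH on every chart
  (`1 ∈ (Φ̄_j) + (∂Φ̄_j/∂T_l : l ≠ j)` in `(R/(c))[T_l : l ≠ j]` for all `j`), then at every point `x'` of the strict transform
  over `p` the local ring **`𝒪_{X',x'}/St_τ(K)_{x'}` of the strict transform `V(St_τ(K))` is a REGULAR local ring**, of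
  dimension `dim 𝒪_{X',x'} − 1` (part 2 `isRegularLocalRing_quotient_strictTransform_of_mem_span` in the model
  `S = 𝒪_{X',x'}` of `B_𝔔`). This is the currency `IsRegularLocalRing (𝒪_{X',x'} ⧸ stalkIdeal C x')` consumed by
  res-type-032's `Scheme.isRegular_subscheme_of_forall_over_closedPoint` (p504250) — «ONE blow-up along `V(J)` makes
  `V(K)` regular over `p` when its tangent cone there is smooth»; with `J` the ideal of a closed point `q̃` of the
  carrier `E_{O′} ≅ ℙ²_{O′}` and `K` the `O′`-model `D = V(F̃ + ϖ′³U)` it is the K4.5e arm-T certificate (1)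
  «`C = Bl_{q̂}(D)` regular» over the tie point (part 3 supplies the Jacobian condition for the tie cubic);
* `isRegularLocalRing_stalk_quotient_strictTransform_of_pderiv` — the point-wise variant with the derivative test at
  the one chart/prime produced by the dictionary replaced by a hypothesis quantified over all charts and primes;
* `map_tieCubic_ne_zero`, **`isRegularLocalRing_stalk_quotient_strictTransform_tieCubic`** — the S-F TIE-POINT INSTANCE:
  `J_p = (c₀, c₁, c₂)` (e.g. the maximal ideal of the 3-dimensional regular local ring of the carrier at `q̃`, parameters
  `ℓ̃₁, ℓ̃₂, ϖ′`), `K_p = (v·c₀c₁(c₀+c₁) + w·c₂³ + Ψ)`, `Ψ ∈ (c)⁴`, `3, v̄, w̄` units of `R/(c)` (part 3's Jacobian condition):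
  `𝒪_{X',x'}/St_τ(K)_{x'}` is regular at EVERY point `x'` of the strict transform over `p`.

Not covered, and said so: points of `V(St_τ(K))` NOT over `supp J` (there `τ` is a local isomorphism), and the global
`Scheme.IsRegular` assembly (needs the locator «special points lie over `p`», cf. res-type-100's
`isRegular_carrierDelta_subscheme` for the pattern).

References: The Stacks Project, Tags 0804, 080C, 0BIQ; Görtz–Wedhorn, *Algebraic Geometry I* (2020), (13.19); Matsumura,
*Commutative Ring Theory*, Thm. 14.2, 19.3; Liu, *Algebraic Geometry and Arithmetic Curves*, Thm. 8.1.19 (a).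
-/

set_option linter.dupNamespace false -- mandated namespace `Summit.<Summit>.<Problem>` of this single-conjunct summit

noncomputable section

open CategoryTheory AlgebraicGeometry TopologicalSpace IsLocalRing
open Literature.AlgebraicGeometry.Resolution
open Summit.ResolutionOfSingularities.ResolutionOfSingularities.Cruxes.EquisingularLift.StrataSplit

namespace Summit.ResolutionOfSingularities.ResolutionOfSingularities.Cruxes.EquisingularLiftNat.Sections

universe u

section Stalks

variable {X X' : Scheme.{u}} {τ : X' ⟶ X} {J : X.IdealSheafData}

set_option maxHeartbeats 400000 in -- the chart algebra `blowupAlgebra` is a subalgebra of a localisation: slow instance unification (as in …NatCarrierDeltaStalks)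
/-- **THE STALKS OF THE STRICT TRANSFORM OF A HYPERSURFACE WITH GIVEN TANGENT CONE.** Let `τ : X' → X` be a blow-up
along `J`, `X'` locally Noetherian, `x' ∈ X'` with `τ x' ∈ supp J`; at `R = 𝒪_{X,τ x'}` let `J_{τ x'} = (c₁, …, c_r)` with `c`
quasi-regular and `R/(c)` a domain, and `K_{τ x'} = (Φ(c) + Ψ)` with `Φ` a form of degree `d`, `Φ mod (c) ≠ 0`,
`Ψ ∈ (c)^{d+1}`. Then for some chart index `j`, a prime `𝔔` of `B = R[I/c_j]` over `𝔪_R`, a ring map `χ : B → 𝒪_{X',x'}`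
extending `τ^♯_{x'}`, a ring isomorphism `e : 𝒪_{X',x'} ≅ B_𝔔` with `e ∘ χ = (·/1)`, and some `ψ ∈ B` presenting the
total transform as `Φ(c) + Ψ = (c_j/1)ᵈ · (Φ(c/c_j) + (c_j/1)·ψ)` (part 1): the exceptional ideal is `E_{x'} = (χ(c_j/1))`,
**the strict transform is `St_τ(K)_{x'} = (χ(Φ(c/c_j) + (c_j/1)ψ))`**, `c_j/1 ∈ 𝔔`, and
`x' ∈ supp St_τ(K) ↔ Φ(c/c_j) + (c_j/1)ψ ∈ 𝔔`. [cite: StacksProject, Tag 0804] [cite: GortzWedhorn2020, (13.19) p. 414] -/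
theorem exists_stalk_strictTransformIdeal_of_tangentCone [IsLocallyNoetherian X'] (hτ : IsBlowup τ J)
    (K : X.IdealSheafData) (x' : X') (hx' : τ x' ∈ (J.support : Set X)) {r : ℕ}
    (c : Fin r → X.presheaf.stalk (τ x')) (hcJ : Ideal.span (Set.range c) = stalkIdeal J (τ x'))
    (hc : IsQuasiRegular c) [IsDomain (X.presheaf.stalk (τ x') ⧸ Ideal.span (Set.range c))]
    {d : ℕ} (Φ : MvPolynomial (Fin r) (X.presheaf.stalk (τ x'))) (hΦd : Φ.IsHomogeneous d)
    (hΦ : MvPolynomial.map (Ideal.Quotient.mk (Ideal.span (Set.range c))) Φ ≠ 0)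
    {Ψ : X.presheaf.stalk (τ x')} (hΨ : Ψ ∈ Ideal.span (Set.range c) ^ (d + 1))
    (hK : stalkIdeal K (τ x') = Ideal.span {MvPolynomial.eval c Φ + Ψ}) :
    ∃ (j : Fin r) (𝔔 : PrimeSpectrum (blowupAlgebra (Ideal.span (Set.range c)) (c j)))
      (χ : blowupAlgebra (Ideal.span (Set.range c)) (c j) →+* X'.presheaf.stalk x')
      (e : X'.presheaf.stalk x' ≃+* Localization.AtPrime 𝔔.asIdeal)
      (ψ : blowupAlgebra (Ideal.span (Set.range c)) (c j)),
      (∀ a, χ (algebraMap _ _ a) = (τ.stalkMap x').hom a) ∧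
      (∀ b, e (χ b) = algebraMap _ (Localization.AtPrime 𝔔.asIdeal) b) ∧
      𝔔.asIdeal.comap (algebraMap _ (blowupAlgebra (Ideal.span (Set.range c)) (c j))) =
        maximalIdeal (X.presheaf.stalk (τ x')) ∧
      algebraMap _ (blowupAlgebra (Ideal.span (Set.range c)) (c j)) (MvPolynomial.eval c Φ + Ψ) =
        algebraMap _ (blowupAlgebra (Ideal.span (Set.range c)) (c j)) (c j) ^ d *
          (MvPolynomial.aeval (blowupAlgebra.frac c j) Φ +
            algebraMap _ (blowupAlgebra (Ideal.span (Set.range c)) (c j)) (c j) * ψ) ∧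
      stalkIdeal (J.comap τ) x' =
        Ideal.span {χ (algebraMap _ (blowupAlgebra (Ideal.span (Set.range c)) (c j)) (c j))} ∧
      stalkIdeal (strictTransformIdeal τ J K) x' =
        Ideal.span {χ (MvPolynomial.aeval (blowupAlgebra.frac c j) Φ +
          algebraMap _ (blowupAlgebra (Ideal.span (Set.range c)) (c j)) (c j) * ψ)} ∧
      algebraMap _ (blowupAlgebra (Ideal.span (Set.range c)) (c j)) (c j) ∈ 𝔔.asIdeal ∧
      (x' ∈ (strictTransformIdeal τ J K).support ↔
        MvPolynomial.aeval (blowupAlgebra.frac c j) Φ +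
          algebraMap _ (blowupAlgebra (Ideal.span (Set.range c)) (c j)) (c j) * ψ ∈ 𝔔.asIdeal) := by
  -- adapted from `exists_stalk_strictTransformIdeal_sup_comap` (…NatCarrierDeltaStalks, the pure-cone case)
  obtain ⟨j, 𝔔, χ, e, hχ, he, h𝔔⟩ :=
    exists_blowupAlgebra_stalk_ringEquiv_of_eq hτ x' c (Ideal.span (Set.range c)) rfl hcJ
  obtain ⟨ψ, hG⟩ := exists_algebraMap_tangentCone_eq c j hΦd hΨ
  letI := χ.toAlgebra
  haveI : IsLocalization.AtPrime (X'.presheaf.stalk x') 𝔔.asIdeal := isLocalization_stalk_of_ringEquiv 𝔔 x' χ e he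
  have hstalkMap : (τ.stalkMap x').hom =
      χ.comp (algebraMap _ (blowupAlgebra (Ideal.span (Set.range c)) (c j))) :=
    RingHom.ext fun a => (hχ a).symm
  -- the stalk of the exceptional ideal
  have hE : stalkIdeal (J.comap τ) x' =
      Ideal.span {χ (algebraMap _ (blowupAlgebra (Ideal.span (Set.range c)) (c j)) (c j))} := by
    rw [stalkIdeal_comap_eq_map_stalkMap, ← hcJ, hstalkMap, ← Ideal.map_map,
      map_blowupAlgebra_eq_span (Ideal.subset_span (Set.mem_range_self j)), Ideal.map_span, Set.image_singleton]
  -- the dehomogenised reduced form is non-zero on every chart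
  have hΦj : MvPolynomial.map (Ideal.Quotient.mk (Ideal.span (Set.range c))) (dehomogenize j Φ) ≠ 0 := by
    rw [map_dehomogenize]
    exact dehomogenize_ne_zero_of_isHomogeneous j (hΦd.map _) hΦ
  -- the stalk of the strict transform: the saturation, computed by part 1 in the localisation `𝒪_{X',x'}`
  have hSt : stalkIdeal (strictTransformIdeal τ J K) x' =
      Ideal.span {χ (MvPolynomial.aeval (blowupAlgebra.frac c j) Φ +
        algebraMap _ (blowupAlgebra (Ideal.span (Set.range c)) (c j)) (c j) * ψ)} := by
    rw [stalkIdeal_strictTransformIdeal, hE, hK, Ideal.map_span, Set.image_singleton, hstalkMap]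
    exact iSup_colon_span_tangentCone_eq_span_strictTransform_localization c j hc hΦj ψ hG 𝔔.asIdeal.primeCompl
      (X'.presheaf.stalk x')
  have ht𝔔 : algebraMap _ (blowupAlgebra (Ideal.span (Set.range c)) (c j)) (c j) ∈ 𝔔.asIdeal := by
    rw [← Ideal.mem_comap, h𝔔]
    have h := (mem_support_iff_stalkIdeal_le J (τ x')).mp hx'
    rw [← hcJ] at h
    exact h (Ideal.subset_span (Set.mem_range_self j))
  refine ⟨j, 𝔔, χ, e, ψ, hχ, he, h𝔔, hG, hE, hSt, ht𝔔, ?_⟩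
  rw [mem_support_iff_stalkIdeal_le, hSt, Ideal.span_singleton_le_iff_mem,
    mem_maximalIdeal_iff_of_stalk_ringEquiv 𝔔 x' χ e he]

/-- **ONE BLOW-UP RESOLVES A HYPERSURFACE POINT WITH SMOOTH PROJECTIVISED TANGENT CONE — stalk form.** In the setting of
`exists_stalk_strictTransformIdeal_of_tangentCone` assume moreover that `R = 𝒪_{X,τ x'}` is a regular local ring, `R/(c)` is a
regular ring, and the affine pieces of the projectivised tangent cone are SMOOTH over the centre on every chart:
`1 ∈ (Φ̄_j) + (∂Φ̄_j/∂T_l : l ≠ j)` in `(R/(c))[T_l : l ≠ j]` for all `j`. Then at every point `x'` of the strict transform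
`V(St_τ(K))` over `τ x' ∈ supp J` the local ring `𝒪_{X',x'}/St_τ(K)_{x'}` is a REGULAR local ring with
`dim + 1 = dim 𝒪_{X',x'}` (part 2 in the model `S = 𝒪_{X',x'}` of `B_𝔔`). With `X = E_{O′} ≅ ℙ²_{O′}`, `J` the ideal of the
tie point `q̃` and `K` the model `D = V(F̃₇ + ϖ′³U)` (tangent cone = the tie cubic, part 3), this is the K4.5e arm-T
certificate «`Bl_q̃(D)` regular over `q̃`». [cite: Matsumura1987, Thm. 14.2] [cite: Liu2002, Thm. 8.1.19 (a)]
[cite: StacksProject, Tag 0804] [OURS · L1 W4.5b] T-EBETA-PRIME toward `stub_elnat_three_isolated_nontc` of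
`EquisingularLiftNatThree` (stmt-ResolutionOfSingularities-20148); NOT a statement of the manuscript. -/
theorem isRegularLocalRing_stalk_quotient_strictTransform_of_mem_span [IsLocallyNoetherian X'] (hτ : IsBlowup τ J)
    (K : X.IdealSheafData) (x' : X') (hx' : τ x' ∈ (J.support : Set X))
    [IsRegularLocalRing (X.presheaf.stalk (τ x'))] {r : ℕ}
    (c : Fin r → X.presheaf.stalk (τ x')) (hcJ : Ideal.span (Set.range c) = stalkIdeal J (τ x'))
    (hc : IsQuasiRegular c) [IsDomain (X.presheaf.stalk (τ x') ⧸ Ideal.span (Set.range c))]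
    [IsRegularRing (X.presheaf.stalk (τ x') ⧸ Ideal.span (Set.range c))]
    {d : ℕ} (Φ : MvPolynomial (Fin r) (X.presheaf.stalk (τ x'))) (hΦd : Φ.IsHomogeneous d)
    (hΦ : MvPolynomial.map (Ideal.Quotient.mk (Ideal.span (Set.range c))) Φ ≠ 0)
    {Ψ : X.presheaf.stalk (τ x')} (hΨ : Ψ ∈ Ideal.span (Set.range c) ^ (d + 1))
    (hK : stalkIdeal K (τ x') = Ideal.span {MvPolynomial.eval c Φ + Ψ})
    (hJac : ∀ j : Fin r, (1 : MvPolynomial {l : Fin r // l ≠ j} (X.presheaf.stalk (τ x') ⧸ Ideal.span (Set.range c))) ∈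
      Ideal.span {MvPolynomial.map (Ideal.Quotient.mk (Ideal.span (Set.range c))) (dehomogenize j Φ)} ⊔
        Ideal.span (Set.range fun l : {l : Fin r // l ≠ j} =>
          MvPolynomial.pderiv l (MvPolynomial.map (Ideal.Quotient.mk (Ideal.span (Set.range c))) (dehomogenize j Φ))))
    (hx'St : x' ∈ (strictTransformIdeal τ J K).support) :
    IsRegularLocalRing (X'.presheaf.stalk x' ⧸ stalkIdeal (strictTransformIdeal τ J K) x') ∧
      ringKrullDim (X'.presheaf.stalk x' ⧸ stalkIdeal (strictTransformIdeal τ J K) x') + 1 =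
        ringKrullDim (X'.presheaf.stalk x') := by
  haveI : IsRegularRing (X.presheaf.stalk (τ x')) := isRegularRing_of_isRegularLocalRing _
  obtain ⟨j, 𝔔, χ, e, ψ, hχ, he, h𝔔, hG, hE, hSt, ht𝔔, hiff⟩ :=
    exists_stalk_strictTransformIdeal_of_tangentCone hτ K x' hx' c hcJ hc Φ hΦd hΦ hΨ hK
  letI := χ.toAlgebra
  haveI : IsLocalization.AtPrime (X'.presheaf.stalk x') 𝔔.asIdeal := isLocalization_stalk_of_ringEquiv 𝔔 x' χ e he
  have hg𝔔 := hiff.mp hx'St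
  obtain ⟨l, hl⟩ := exists_pderiv_coneTransform_notMem_of_mem_span c j hc Φ (hJac j) ψ 𝔔.asIdeal ht𝔔 hg𝔔
  have h := isRegularLocalRing_quotient_strictTransform c j hc Φ ψ 𝔔.asIdeal ht𝔔 hg𝔔 l hl (X'.presheaf.stalk x')
  rw [hSt]
  exact h

/-- **The same with the derivative test as a hypothesis at all charts and primes** (for tangent cones smooth only along
part of the exceptional divisor): if for every chart `j` and every prime `𝔔` of `R[I/c_j]` containing `c_j/1` and the
strict transform `g₁` some `(∂Φ_j/∂T_l)(c/c_j) ∉ 𝔔`, then `𝒪_{X',x'}/St_τ(K)_{x'}` is regular at every point `x'` of the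
strict transform over `τ x'`. [cite: Matsumura1987, Thm. 14.2] [cite: StacksProject, Tag 0804] [OURS · L1 W4.5b]
T-EBETA-PRIME; NOT a statement of the manuscript. -/
theorem isRegularLocalRing_stalk_quotient_strictTransform_of_pderiv [IsLocallyNoetherian X'] (hτ : IsBlowup τ J)
    (K : X.IdealSheafData) (x' : X') (hx' : τ x' ∈ (J.support : Set X))
    [IsRegularLocalRing (X.presheaf.stalk (τ x'))] {r : ℕ}
    (c : Fin r → X.presheaf.stalk (τ x')) (hcJ : Ideal.span (Set.range c) = stalkIdeal J (τ x'))
    (hc : IsQuasiRegular c) [IsDomain (X.presheaf.stalk (τ x') ⧸ Ideal.span (Set.range c))]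
    [IsRegularRing (X.presheaf.stalk (τ x') ⧸ Ideal.span (Set.range c))]
    {d : ℕ} (Φ : MvPolynomial (Fin r) (X.presheaf.stalk (τ x'))) (hΦd : Φ.IsHomogeneous d)
    (hΦ : MvPolynomial.map (Ideal.Quotient.mk (Ideal.span (Set.range c))) Φ ≠ 0)
    {Ψ : X.presheaf.stalk (τ x')} (hΨ : Ψ ∈ Ideal.span (Set.range c) ^ (d + 1))
    (hK : stalkIdeal K (τ x') = Ideal.span {MvPolynomial.eval c Φ + Ψ})
    (htest : ∀ (j : Fin r) (𝔔 : Ideal (blowupAlgebra (Ideal.span (Set.range c)) (c j))) [𝔔.IsPrime]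
      (ψ : blowupAlgebra (Ideal.span (Set.range c)) (c j)),
      algebraMap _ (blowupAlgebra (Ideal.span (Set.range c)) (c j)) (c j) ∈ 𝔔 →
      MvPolynomial.aeval (blowupAlgebra.frac c j) Φ +
          algebraMap _ (blowupAlgebra (Ideal.span (Set.range c)) (c j)) (c j) * ψ ∈ 𝔔 →
      ∃ l : {l : Fin r // l ≠ j}, blowupAlgebra.eval c j (MvPolynomial.pderiv l (dehomogenize j Φ)) ∉ 𝔔)
    (hx'St : x' ∈ (strictTransformIdeal τ J K).support) :
    IsRegularLocalRing (X'.presheaf.stalk x' ⧸ stalkIdeal (strictTransformIdeal τ J K) x') ∧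
      ringKrullDim (X'.presheaf.stalk x' ⧸ stalkIdeal (strictTransformIdeal τ J K) x') + 1 =
        ringKrullDim (X'.presheaf.stalk x') := by
  haveI : IsRegularRing (X.presheaf.stalk (τ x')) := isRegularRing_of_isRegularLocalRing _
  obtain ⟨j, 𝔔, χ, e, ψ, hχ, he, h𝔔, hG, hE, hSt, ht𝔔, hiff⟩ :=
    exists_stalk_strictTransformIdeal_of_tangentCone hτ K x' hx' c hcJ hc Φ hΦd hΦ hΨ hK
  letI := χ.toAlgebra
  haveI : IsLocalization.AtPrime (X'.presheaf.stalk x') 𝔔.asIdeal := isLocalization_stalk_of_ringEquiv 𝔔 x' χ e he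
  have hg𝔔 := hiff.mp hx'St
  obtain ⟨l, hl⟩ := htest j 𝔔.asIdeal ψ ht𝔔 hg𝔔
  have h := isRegularLocalRing_quotient_strictTransform c j hc Φ ψ 𝔔.asIdeal ht𝔔 hg𝔔 l hl (X'.presheaf.stalk x')
  rw [hSt]
  exact h

/-! ## The S-F tie-point instance -/

/-- The tie cubic has non-zero reduction: `Φ̄ = v̄·T₀T₁(T₀+T₁) + w̄·T₂³ ≠ 0` when `w̄ ≠ 0` (evaluate at `(0, 0, 1)`).
[folklore] -/
theorem map_tieCubic_ne_zero {R : Type u} [CommRing R] (I : Ideal R) (v w : R) (hw : Ideal.Quotient.mk I w ≠ 0) :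
    MvPolynomial.map (Ideal.Quotient.mk I)
      (MvPolynomial.C v * (MvPolynomial.X 0 * MvPolynomial.X 1 * (MvPolynomial.X 0 + MvPolynomial.X 1)) +
        MvPolynomial.C w * MvPolynomial.X 2 ^ 3 : MvPolynomial (Fin 3) R) ≠ 0 := by
  intro h
  have h2 := congrArg (MvPolynomial.eval fun i : Fin 3 => if i = 2 then (1 : R ⧸ I) else 0) h
  simp only [map_add, map_mul, map_pow, MvPolynomial.map_C, MvPolynomial.map_X, MvPolynomial.eval_C,
    MvPolynomial.eval_X, map_zero] at h2
  simp only [Fin.isValue, Fin.reduceEq, ↓reduceIte, mul_zero, zero_add, one_pow, mul_one] at h2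
  exact hw h2

set_option maxHeartbeats 400000 in -- as above
/-- **T-EBETA-PRIME AT AN S-F TIE POINT, stalk form: the (E-β′) centre `Bl_q̃(D)` is regular at every point over `q̃`.**
`τ : X' → X` a blow-up along `J`, `X'` locally Noetherian, `x' ∈ X'` over `p ∈ supp J` with `R = 𝒪_{X,p}` a regular local
ring, `J_p = (c₀, c₁, c₂)` with `c` quasi-regular, `R/(c)` a regular domain (for the blow-up of the POINT `q̃` of the
3-dimensional carrier: `c` a regular system of parameters `ℓ̃₁, ℓ̃₂, ϖ′`, `R/(c) = k`), `3`, `v̄`, `w̄` units of `R/(c)`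
(residue characteristic `2` at S-F), and `K_p = (v·c₀c₁(c₀+c₁) + w·c₂³ + Ψ)` with `Ψ ∈ (c)⁴` (the `O′`-model
`D = V(F̃₇ + ϖ′³U)` of PLANNER-MEMO g7-1 M3 / LEAD-MEMO-2 §6 in local parameters at `q̃_j`). Then at every point `x'` of
the strict transform `V(St_τ(K))` over `p`, `𝒪_{X',x'}/St_τ(K)_{x'}` is a REGULAR local ring with `dim + 1 = dim 𝒪_{X',x'}`:
part 3's Jacobian condition for the tie cubic on all three charts, fed into
`isRegularLocalRing_stalk_quotient_strictTransform_of_mem_span`. [cite: Matsumura1987, Thm. 14.2]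
[cite: StacksProject, Tag 0804] [OURS · L1 W4.5b] K4.5e arm T route T-B certificate (1) in the kernel, modulo the E1 jet
matching and the global gluing; NOT a statement of the manuscript. -/
theorem isRegularLocalRing_stalk_quotient_strictTransform_tieCubic [IsLocallyNoetherian X'] (hτ : IsBlowup τ J)
    (K : X.IdealSheafData) (x' : X') (hx' : τ x' ∈ (J.support : Set X))
    [IsRegularLocalRing (X.presheaf.stalk (τ x'))]
    (c : Fin 3 → X.presheaf.stalk (τ x')) (hcJ : Ideal.span (Set.range c) = stalkIdeal J (τ x'))
    (hc : IsQuasiRegular c) [IsDomain (X.presheaf.stalk (τ x') ⧸ Ideal.span (Set.range c))]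
    [IsRegularRing (X.presheaf.stalk (τ x') ⧸ Ideal.span (Set.range c))]
    (v w : X.presheaf.stalk (τ x')) (h3 : IsUnit (3 : X.presheaf.stalk (τ x') ⧸ Ideal.span (Set.range c)))
    (hv : IsUnit (Ideal.Quotient.mk (Ideal.span (Set.range c)) v))
    (hw : IsUnit (Ideal.Quotient.mk (Ideal.span (Set.range c)) w))
    {Ψ : X.presheaf.stalk (τ x')} (hΨ : Ψ ∈ Ideal.span (Set.range c) ^ (3 + 1))
    (hK : stalkIdeal K (τ x') = Ideal.span {MvPolynomial.eval c
      (MvPolynomial.C v * (MvPolynomial.X 0 * MvPolynomial.X 1 * (MvPolynomial.X 0 + MvPolynomial.X 1)) +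
        MvPolynomial.C w * MvPolynomial.X 2 ^ 3 : MvPolynomial (Fin 3) (X.presheaf.stalk (τ x'))) + Ψ})
    (hx'St : x' ∈ (strictTransformIdeal τ J K).support) :
    IsRegularLocalRing (X'.presheaf.stalk x' ⧸ stalkIdeal (strictTransformIdeal τ J K) x') ∧
      ringKrullDim (X'.presheaf.stalk x' ⧸ stalkIdeal (strictTransformIdeal τ J K) x') + 1 =
        ringKrullDim (X'.presheaf.stalk x') :=
  isRegularLocalRing_stalk_quotient_strictTransform_of_mem_span hτ K x' hx' c hcJ hc _ (isHomogeneous_tieCubic v w)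
    (map_tieCubic_ne_zero _ v w hw.ne_zero) hΨ hK (one_mem_jacobian_tieCubic c v w h3 hv hw) hx'St

end Stalks

end Summit.ResolutionOfSingularities.ResolutionOfSingularities.Cruxes.EquisingularLiftNat.Sections

end
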